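import Summits.BirchSwinnertonDyer.BirchSwinnertonDyer.Theorems.EisensteinPrimesMazurMCOnCellBTwistbackSubrowPartnerAnyLinePAdicGZ
import Summits.BirchSwinnertonDyer.BirchSwinnertonDyer.Theorems.EisensteinPrimesMazurMCOnCellBTwistbackOnePartnerAt
import Summits.BirchSwinnertonDyer.Rank1Residual.X2.IsogenyClassStability
import Summits.BirchSwinnertonDyer.Rank1Residual.X2.RankOneHeegnerExact
import Literature.NumberTheory.EllipticCurves.TateCurve.NumberFieldUniformization
import Literature.NumberTheory.EllipticCurves.TateCurve.NumberFieldUniformizationTwisted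
import HarnessLib

/-!
# Crux 3 `MazurMCOnCellB` (stmt-BirchSwinnertonDyer-19033), line `twistback` v9 — ISOGENY TRANSPORT INSIDE THE CONE:
# X2b, `BSD_p` and Mazur's main conjecture move along a `ℚ`-isogeny from `PublishedInputs` ALONE, and the SUB-ROW branch
# becomes isogeny-invariant («some minimal `W₁ ~ W` is on the closed sub-row» ⟹ MC at `(W, 3)`)

Width seat bsd-line-x2-p1-w7 (gen 3), cell `bsd-eis` (run/shared/lean/pub/bsd-eis/), 2026-08-28; `--supports
stmt-BirchSwinnertonDyer-19033 --as helper`. THEOREMS ONLY (no `def`, no named fact introduced, no `sorry`).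

WHY. The registered v9 skeleton (`Cruxes/MazurMCOnCellB/Lines/twistback.lean`, LEAD x2-p1 g14, sha256 c4adf2f8…) composes
`MazurMCOnCellB_of` PER PAIR with three branches — Ш-unit class (PUB road), REACHABLE Ш-unit class (chain road), and
`upperPartner_offReachable` = «SUB-ROW at `W` itself (`upperPartner_onSubrow`, width seat w3 g11's p661280
`upperPartner_at_three_of_balanceOne_of_padicGZ`) or the open stub». The first two branches are isogeny-invariant by
construction; the THIRD is not: the sub-row datum (a rational `3`-line of `W` with its characters and Greenberg–Vatsal balance)
is asked AT `W`. This seat's kernel isogeny certificates (`…A10IsogenyCertificates01–22`, `…Two01–07`: `IsIsogenous Eᵢ Eⱼ` for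
every pair of Cremona members of all 127 A10 classes, 29 files, p671549 … p673435) make the following one-token widening
dischargeable per pair: «∃ globally minimal `W₁ ~ W` ON the sub-row» ⟹ Mazur's main conjecture at `(W, 3)`. This file types
the class-wide doors for it, fed from the v9 cone BY NAME and from NOTHING ELSE:
* §1 `cellB_iff_of_isIsogenous` — `X2.CellB` along a `ℚ`-isogeny with BOTH Tate-uniformisation facts DISCHARGED by the tree's
  `TateCurve.Silverman1994_thmV53_…_holds` (the form w8 g4 used inline in p672107);
* §2 `bsdp_of_isIsogenous_of_publishedInputs`, `mazurMainConjectureAt_of_isIsogenous_of_publishedInputs` — Cassels transport of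
  `BSD(E,p)` and the MC transport `X2.mazurMainConjectureAt_of_isIsogenous` (MC ⟹ BSD_p ⟹ Cassels ⟹ BSD_p ⟹ exact converse) with
  their TEN named-fact binders (Cassels, modular parametrisation, newforms, GZK, Wuthrich Thm. 16, Stein–Wuthrich 6.1 ×2,
  canonical subgroups ×2, Greenberg–Stevens) all projected out of the route's ONE bundle `EisensteinPrimes.PublishedInputs`
  (item -19037; conjuncts 2, 5, 6, 11, 15–20) — so inside the skeleton they cost `stub_publishedInputs` only;
* §3 `mazurMainConjectureAt_of_isIsogenous_of_subrowDatum` — THE ISOGENY-INVARIANT SUB-ROW BRANCH: for `W₁ ~ W` (both globally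
  minimal), `X2.CellB W₁ 3`, `3` non-split for `W₁`, and the skeleton's sub-row existential AT `W₁` VERBATIM (the `hbal` binder
  of p661280), Mazur's main conjecture holds at `(W, 3)` — modulo exactly the named facts of v9's sub-row path: `PublishedInputs`,
  Disegni 2020 Thm. 4(1) / Thm. 2.4, Greenberg–Vatsal (3.11), Nakagawa–Horie–Taya (the ∃-PARTNER door), Poitou–Tate ×2, Hsieh
  2014, Liu–Zhang–Zhang 2018, Mazur 1978 Cor. 4.1 and Keller–Yin Thm. D (PRE) (w6 g2's per-pair door p663790
  `mazurMainConjectureAt_of_cellB_of_upper_partnerAt`), i.e. stubs 1, 2, 3a of the line. Proof: ∃-PARTNER at `W₁` → a minimal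
  model of the twist (`exists_isGloballyMinimal_smul_eq_quadraticTwist`) → MC at `(W₁, 3)` → §2 → MC at `(W, 3)`;
* §4 the same with the roles named as the LEAD would consume them (`W` the crux's curve, the datum on `W₁`), and the
  `X2.CellB W 3`-hypothesis version (X2b read at `W`, moved to `W₁` by §1).
USE (said, not filed — W-71): a v10 may replace `upperPartner_onSubrow`'s «sub-row at `W`» by «sub-row at some minimal `W₁ ~ W`»
with §3 as the derived branch; per pair, this seat's 30 `subrowDatum_<label>` theorems + the certificates then put EVERY Cremona
member of the 30 sub-row classes (not only the representative) in the derived population.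

HONEST FRAMING (FULL-BSD rank-`≤ 1` programme D-0033; row A10 = X2b at `p = 3`): CONDITIONAL theorems, named facts BY NAME exactly
as in their binders (PUBLISHED except Keller–Yin Thm. D = PREPRINT = the line's FACT stub `stub_thmD`); closes no stub; nothing is
booked; 0 cells / labels / stubs / tiers move; no summit statement / Mazur MC / BSD is proved unconditionally for any curve.

References: J. W. S. Cassels, J. reine angew. Math. 217 (1965) / J. S. Milne, ADT Thm. I.7.3 [MilneADT2006]; C. Wuthrich,
J. London Math. Soc. 90 (2014) Thm. 16, Lemma 17 [Wuthrich2014]; J. H. Silverman, *Advanced Topics* V.5.3 / V.5.4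
[SilvermanATAEC1994]; R. Greenberg, V. Vatsal, Invent. Math. 142 (2000) Thm. (3.11) [GreenbergVatsal2000]; D. Disegni, Kyoto J.
Math. 60 (2020) Thm. 2.4, Thm. 4 [Disegni2020]; T. Keller, M. Yin, arXiv:2402.12781v2 Thm. D [KellerYin2024].
-/

set_option autoImplicit false
-- `Summit.BirchSwinnertonDyer.BirchSwinnertonDyer.…`: the summit and its single sub-problem share a name.
set_option linter.dupNamespace false

noncomputable section

open scoped Classical NumberTheorySymbols

open WeierstrassCurve NumberField IsDedekindDomain Field DirichletCharacter
  Literature.NumberTheory.EllipticCurves Literature.NumberTheory.GaloisRepresentations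
  Literature.NumberTheory.EllipticCurves.ModularForms Literature.NumberTheory.QuadraticFields
  Literature.NumberTheory.GaloisCohomology
  Literature.NumberTheory.EllipticCurves.Rank1Residual Literature.NumberTheory.EllipticCurves.Rank1Residual.Typed
  Literature.NumberTheory.EllipticCurves.GreenbergVatsal2000 Literature.NumberTheory.EllipticCurves.Disegni2020
  Literature.NumberTheory.EllipticCurves.TateCurve
  Summit.BirchSwinnertonDyer.Rank1Residual Summit.BirchSwinnertonDyer.Rank1Residual.X2
  Summit.BirchSwinnertonDyer.BirchSwinnertonDyer.Theses
  Summit.BirchSwinnertonDyer.BirchSwinnertonDyer.Theorems.EisensteinPrimesMazurMCOnCellBTwistbackSubrowPartnerAnyLinePAdicGZ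
  Summit.BirchSwinnertonDyer.BirchSwinnertonDyer.Theorems.EisensteinPrimesMazurMCOnCellBTwistbackOnePartnerAt

namespace Summit.BirchSwinnertonDyer.BirchSwinnertonDyer.Theorems.EisensteinPrimesMazurMCOnCellBTwistbackIsogenyTransport

/-! ## §1 X2b along a `ℚ`-isogeny, Tate uniformisation discharged -/

/-- **Sub-cell X2b is a property of the `ℚ`-isogeny class**, with BOTH Tate-uniformisation facts of
`X2.cellB_iff_of_isIsogenous` DISCHARGED by the tree (`TateCurve.Silverman1994_thmV53_tateUniformisation_holds`,
`…_corV54_tateUniformisation_holds`). Unconditional. [cite: SilvermanATAEC1994, Thm. V.5.3 and Cor. V.5.4]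
[cite: GreenbergVatsal2000, Thm. (1.3) and §2 p. 28] -/
theorem cellB_iff_of_isIsogenous {W W' : WeierstrassCurve ℚ} [W.IsElliptic] [W'.IsElliptic] [W.IsGloballyMinimal]
    [W'.IsGloballyMinimal] {p : ℕ} [Fact p.Prime] (hiso : IsIsogenous W W') : X2.CellB W p ↔ X2.CellB W' p :=
  X2.cellB_iff_of_isIsogenous Silverman1994_thmV53_tateUniformisation_holds
    Silverman1994_thmV53_corV54_tateUniformisation_holds hiso

/-! ## §2 `BSD(E,p)` and Mazur's main conjecture along a `ℚ`-isogeny, from `PublishedInputs` alone -/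

/-- **Cassels transport of `BSD(E, p)` inside the cone**: `W ~ W'`, `r_an(W) ≤ 1`, `BSD(W, p)` ⟹ `BSD(W', p)` — the tree's
`X2.bsdp_of_isIsogenous_of_bsdp` with Cassels (conjunct 2), newforms ⟹ entire `L` (conjunct 6) and GZK (conjunct 11) projected out of
`EisensteinPrimes.PublishedInputs`. [cite: MilneADT2006, Thm. I.7.3 and Rem. I.7.4] -/
theorem bsdp_of_isIsogenous_of_publishedInputs (hP : EisensteinPrimes.PublishedInputs)
    {W W' : WeierstrassCurve ℚ} [W.IsElliptic] [W'.IsElliptic] [W.IsGloballyMinimal] [W'.IsGloballyMinimal]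
    (hiso : IsIsogenous W W') (p : ℕ) [Fact p.Prime] (hr : W.analyticRank ≤ 1) (h : BSDp W p) : BSDp W' p :=
  X2.bsdp_of_isIsogenous_of_bsdp hP.2.1 hP.2.2.2.2.2.2.2.2.2.2.1
    (WeierstrassCurve.hasEntireLFunction_rat_of_exists_isNewformOf hP.2.2.2.2.2.1) W W' hiso p hr h

/-- **Mazur's main conjecture at an X2b pair is a `ℚ`-isogeny invariant, inside the cone**: `W ~ W'` (both globally minimal),
`(W, p)` X2b, MC at `(W, p)` ⟹ MC at `(W', p)` — the tree's `X2.mazurMainConjectureAt_of_isIsogenous` (MC ⟹ `BSD(W,p)` ⟹ Cassels ⟹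
`BSD(W',p)` ⟹ exact converse at a reducible rank-zero multiplicative pair) with its ten named-fact binders projected out of
`EisensteinPrimes.PublishedInputs` (conjuncts 2, 5, 6, 11, 15, 16, 17, 18, 19, 20: Cassels, modular parametrisation, newforms, GZK,
Wuthrich Thm. 16, Stein–Wuthrich Thm. 6.1 split / non-split, canonical subgroups ×2, Greenberg–Stevens). CONDITIONAL on
`PublishedInputs` only. [cite: Wuthrich2014, Thm. 16 and Lemma 17 (p. 397)] [cite: MilneADT2006, Thm. I.7.3] -/
theorem mazurMainConjectureAt_of_isIsogenous_of_publishedInputs (hP : EisensteinPrimes.PublishedInputs)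
    {W W' : WeierstrassCurve ℚ} [W.IsElliptic] [W'.IsElliptic] [W.IsGloballyMinimal] [W'.IsGloballyMinimal]
    (hiso : IsIsogenous W W') (p : ℕ) [Fact p.Prime] (hc : X2.CellB W p) (hMC : X2.MazurMainConjectureAt W p) :
    X2.MazurMainConjectureAt W' p :=
  X2.mazurMainConjectureAt_of_isIsogenous hP.2.2.2.2.2.2.2.2.2.2.2.2.2.2.1 hP.2.2.2.2.2.2.2.2.2.2.2.2.2.2.2.1
    hP.2.2.2.2.2.2.2.2.2.2.2.2.2.2.2.2.1 hP.2.2.2.2.2.2.2.2.2.2.2.2.2.2.2.2.2.1 hP.2.2.2.2.2.2.2.2.2.2.2.2.2.2.2.2.2.2.1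
    hP.2.2.2.2.2.2.2.2.2.2.1 hP.2.2.2.2.2.1 hP.2.2.2.2.1 hP.2.1 hP.2.2.2.2.2.2.2.2.2.2.2.2.2.2.2.2.2.2.2 hiso p hc.2.1.1
    hc.2.1.2.2 hc.2.1.2.1 hc.1 hMC

/-- The same with X2b read at the TARGET `W'` (moved back to `W` by §1). CONDITIONAL on `PublishedInputs` only.
[cite: Wuthrich2014, Thm. 16 and Lemma 17 (p. 397)] -/
theorem mazurMainConjectureAt_of_isIsogenous_of_publishedInputs' (hP : EisensteinPrimes.PublishedInputs)
    {W W' : WeierstrassCurve ℚ} [W.IsElliptic] [W'.IsElliptic] [W.IsGloballyMinimal] [W'.IsGloballyMinimal]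
    (hiso : IsIsogenous W W') (p : ℕ) [Fact p.Prime] (hc' : X2.CellB W' p) (hMC : X2.MazurMainConjectureAt W p) :
    X2.MazurMainConjectureAt W' p :=
  mazurMainConjectureAt_of_isIsogenous_of_publishedInputs hP hiso p ((cellB_iff_of_isIsogenous hiso).mpr hc') hMC

/-! ## §3 The isogeny-invariant SUB-ROW branch -/

/-- **Mazur's main conjecture at `(W, 3)` from the closed SUB-ROW at ANY globally minimal `W₁ ~ W`.** Inputs: `IsIsogenous W₁ W`;
`X2.CellB W₁ 3`; `3` non-split for `W₁`; the skeleton's sub-row existential AT `W₁` VERBATIM (binder `hbal` of p661280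
`upperPartner_at_three_of_balanceOne_of_padicGZ`); named facts BY NAME = exactly those of v9's sub-row path (`PublishedInputs`; Disegni
2020 Thm. 4(1) `padicBSD_rankOne_nonsplitMult`, Greenberg–Vatsal (3.11) `thm311_…`, Disegni 2020 Thm. 2.4 `padicGrossZagier_nonsplitMult`,
Nakagawa–Horie–Taya; Poitou–Tate ×2, Hsieh 2014, Liu–Zhang–Zhang 2018, Mazur 1978 Cor. 4.1; Keller–Yin Thm. D — PREPRINT).
Proof: the ∃-PARTNER at `W₁` (p661280) → a minimal model of the twist (`exists_isGloballyMinimal_smul_eq_quadraticTwist`) → MC at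
`(W₁, 3)` by w6 g2's p663790 `mazurMainConjectureAt_of_cellB_of_upper_partnerAt` → §2 → MC at `(W, 3)`. CONDITIONAL on the named facts;
nothing booked. [claim: KellerYin2024, status: under-review] [cite: KellerYin2024, Thm. D (= Thm. 5.1.3) (hypothesis)]
[cite: Disegni2020, §2.2 Thm. 2.4 and §3.2 Thm. 4] [cite: GreenbergVatsal2000, §3 Thm. (3.11)] [cite: Wuthrich2014, Thm. 16 and Lemma 17] -/
theorem mazurMainConjectureAt_of_isIsogenous_of_subrowDatum (hP : EisensteinPrimes.PublishedInputs)
    (hPT : ∀ (K : Type) [Field K] [NumberField K], poitouTate_selmerStructure_duality K)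
    (hPT2 : ∀ (K : Type) [Field K] [NumberField K], poitouTate_sha_tateDual K)
    (hH : hsieh2014_exists_anticyclotomicPAdicLFunction)
    (hF : LiuZhangZhang2018.thm151_thm153_modularCurve_heegnerVector) (hMaz : mazur_not_dvd_maninConstant_of_odd)
    (hDis : padicBSD_rankOne_nonsplitMult) (h311 : thm311_hasUnitContent_iff_and_order_eq_of_lineRamifiedEven)
    (hDGZ : padicGrossZagier_nonsplitMult)
    (hNH : Literature.NumberTheory.QuadraticFields.nakagawaHorie_taya_exists_imaginary_h3_eq_one)
    (hD : KellerYin2024.thmD_imcMult_exists_isBDPLFunction_isTorsion_charIdeal_eq_OPEN)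
    {W₁ W : WeierstrassCurve ℚ} [W₁.IsElliptic] [W.IsElliptic] [W₁.IsGloballyMinimal] [W.IsGloballyMinimal]
    (hiso : IsIsogenous W₁ W) (hc₁ : X2.CellB W₁ 3) (hns₁ : ¬ W₁.HasSplitMultiplicativeReductionAtPrime 3)
    (hbal : ∃ (Φ₀ : AddSubgroup (geomTorsion W₁ (3 : ℤ))) (m : ℕ) (_ : NeZero m) (φ : DirichletCharacter (ZMod 3) m)
        (d : ℕ) (_ : NeZero d) (ψ : DirichletCharacter (ZMod 3) d) (S₀ : Finset (HeightOneSpectrum (𝓞 ℚ))),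
      IsRationalLine W₁ 3 Φ₀ ∧ φ.IsPrimitive ∧ ψ.IsPrimitive ∧
      (∀ (σ : absoluteGaloisGroup ℚ), ∀ P ∈ Φ₀,
        σ • P = (φ ((modNCyclotomicCharacter ℚ m σ : (ZMod m)ˣ) : ZMod m)).val • P) ∧
      (∀ (σ : absoluteGaloisGroup ℚ) (P : geomTorsion W₁ (3 : ℤ)),
        σ • P - (ψ ((modNCyclotomicCharacter ℚ d σ : (ZMod d)ˣ) : ZMod d)).val • P ∈ Φ₀) ∧
      (∀ v ∈ S₀, ((3 : ℕ) : 𝓞 ℚ) ∉ v.asIdeal) ∧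
      (∀ v : HeightOneSpectrum (𝓞 ℚ), v ∉ S₀ → ((3 : ℕ) : 𝓞 ℚ) ∉ v.asIdeal → W₁.HasGoodReductionAt v) ∧
      1 + ∑ v ∈ S₀, delta W₁ 3 v =
        ∑ v ∈ S₀, ((if φ (Rat.HeightOneSpectrum.natGenerator v : ZMod m) =
              (Rat.HeightOneSpectrum.natGenerator v : ZMod 3)
            then sFactor 3 (Rat.HeightOneSpectrum.natGenerator v) else 0) +
          (if ψ (Rat.HeightOneSpectrum.natGenerator v : ZMod d) =
              (Rat.HeightOneSpectrum.natGenerator v : ZMod 3)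
            then sFactor 3 (Rat.HeightOneSpectrum.natGenerator v) else 0))) :
    X2.MazurMainConjectureAt W 3 := by
  obtain ⟨K, _, _, hK, hHN, hHp, hodd, hlt, hr1, hU⟩ :=
    upperPartner_at_three_of_balanceOne_of_padicGZ hP hDis h311 hDGZ hNH W₁ hc₁ hns₁ hbal
  have hd0 : (NumberField.discr K : ℚ) ≠ 0 := by exact_mod_cast NumberField.discr_ne_zero K
  haveI := W₁.isElliptic_quadraticTwist hd0
  obtain ⟨Wd, _, _, C, hC⟩ := exists_isGloballyMinimal_smul_eq_quadraticTwist W₁ hd0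
  have hMC₁ : X2.MazurMainConjectureAt W₁ 3 :=
    mazurMainConjectureAt_of_cellB_of_upper_partnerAt hP hPT hPT2 hH hF hMaz hD W₁ 3 hc₁ K hK hHN hHp hodd hlt hr1 Wd ⟨C, hC⟩
      (hU Wd ⟨C, hC⟩)
  exact mazurMainConjectureAt_of_isIsogenous_of_publishedInputs hP hiso 3 hc₁ hMC₁

/-! ## §4 The branch in the LEAD's orientation: the crux's `W`, X2b read at `W`, the datum carried by some `W₁ ~ W` -/

/-- **v10-shaped sub-row branch**: for the crux's pair `(W, 3)` with `X2.CellB W 3`, IF there is a globally minimal `W₁` with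
`IsIsogenous W W₁`, `3` non-split for `W₁` and the sub-row datum at `W₁`, THEN Mazur's main conjecture holds at `(W, 3)` — X2b moves
to `W₁` by §1, the isogeny is reversed by the dual (`IsIsogenous.symm_of_charZero`), and §3 concludes. Same named facts as §3;
CONDITIONAL; nothing booked. [claim: KellerYin2024, status: under-review] [cite: KellerYin2024, Thm. D (= Thm. 5.1.3) (hypothesis)]
[cite: Disegni2020, §2.2 Thm. 2.4 and §3.2 Thm. 4] [cite: GreenbergVatsal2000, §3 Thm. (3.11)] [cite: SilvermanAEC2009, Thm. III.6.1] -/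
theorem mazurMainConjectureAt_of_cellB_of_exists_isIsogenous_subrowDatum (hP : EisensteinPrimes.PublishedInputs)
    (hPT : ∀ (K : Type) [Field K] [NumberField K], poitouTate_selmerStructure_duality K)
    (hPT2 : ∀ (K : Type) [Field K] [NumberField K], poitouTate_sha_tateDual K)
    (hH : hsieh2014_exists_anticyclotomicPAdicLFunction)
    (hF : LiuZhangZhang2018.thm151_thm153_modularCurve_heegnerVector) (hMaz : mazur_not_dvd_maninConstant_of_odd)
    (hDis : padicBSD_rankOne_nonsplitMult) (h311 : thm311_hasUnitContent_iff_and_order_eq_of_lineRamifiedEven)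
    (hDGZ : padicGrossZagier_nonsplitMult)
    (hNH : Literature.NumberTheory.QuadraticFields.nakagawaHorie_taya_exists_imaginary_h3_eq_one)
    (hD : KellerYin2024.thmD_imcMult_exists_isBDPLFunction_isTorsion_charIdeal_eq_OPEN)
    (W : WeierstrassCurve ℚ) [W.IsElliptic] [W.IsGloballyMinimal] (hc : X2.CellB W 3)
    (h : ∃ (W₁ : WeierstrassCurve ℚ) (_ : W₁.IsElliptic) (_ : W₁.IsGloballyMinimal),
      IsIsogenous W W₁ ∧ ¬ W₁.HasSplitMultiplicativeReductionAtPrime 3 ∧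
      ∃ (Φ₀ : AddSubgroup (geomTorsion W₁ (3 : ℤ))) (m : ℕ) (_ : NeZero m) (φ : DirichletCharacter (ZMod 3) m)
        (d : ℕ) (_ : NeZero d) (ψ : DirichletCharacter (ZMod 3) d) (S₀ : Finset (HeightOneSpectrum (𝓞 ℚ))),
      IsRationalLine W₁ 3 Φ₀ ∧ φ.IsPrimitive ∧ ψ.IsPrimitive ∧
      (∀ (σ : absoluteGaloisGroup ℚ), ∀ P ∈ Φ₀,
        σ • P = (φ ((modNCyclotomicCharacter ℚ m σ : (ZMod m)ˣ) : ZMod m)).val • P) ∧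
      (∀ (σ : absoluteGaloisGroup ℚ) (P : geomTorsion W₁ (3 : ℤ)),
        σ • P - (ψ ((modNCyclotomicCharacter ℚ d σ : (ZMod d)ˣ) : ZMod d)).val • P ∈ Φ₀) ∧
      (∀ v ∈ S₀, ((3 : ℕ) : 𝓞 ℚ) ∉ v.asIdeal) ∧
      (∀ v : HeightOneSpectrum (𝓞 ℚ), v ∉ S₀ → ((3 : ℕ) : 𝓞 ℚ) ∉ v.asIdeal → W₁.HasGoodReductionAt v) ∧
      1 + ∑ v ∈ S₀, delta W₁ 3 v =
        ∑ v ∈ S₀, ((if φ (Rat.HeightOneSpectrum.natGenerator v : ZMod m) =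
              (Rat.HeightOneSpectrum.natGenerator v : ZMod 3)
            then sFactor 3 (Rat.HeightOneSpectrum.natGenerator v) else 0) +
          (if ψ (Rat.HeightOneSpectrum.natGenerator v : ZMod d) =
              (Rat.HeightOneSpectrum.natGenerator v : ZMod 3)
            then sFactor 3 (Rat.HeightOneSpectrum.natGenerator v) else 0))) :
    X2.MazurMainConjectureAt W 3 := by
  obtain ⟨W₁, _, _, hiso, hns₁, hbal⟩ := h
  have hc₁ : X2.CellB W₁ 3 := (cellB_iff_of_isIsogenous hiso).mp hc
  exact mazurMainConjectureAt_of_isIsogenous_of_subrowDatum hP hPT hPT2 hH hF hMaz hDis h311 hDGZ hNH hD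
    (IsIsogenous.symm_of_charZero hiso) hc₁ hns₁ hbal

end Summit.BirchSwinnertonDyer.BirchSwinnertonDyer.Theorems.EisensteinPrimesMazurMCOnCellBTwistbackIsogenyTransport

end
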